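import Literature.Barriers.CriticalPhenomena.SAPAnisotropicNotDFinite
import Literature.Probability.RandomPlanarGeometry.SAWPolygonsFromBridges
import Literature.Probability.RandomPlanarGeometry.SAWPositiveWalks
import Literature.Probability.RandomPlanarGeometry.HammersleyWelshBound
import Mathlib.Analysis.SpecificLimits.Normed
import HarnessLib

/-!
# `μ_Polygon = μ` on `ℤ²` (Madras–Slade 1993, Corollary 3.2.5): discharge of
# `MadrasSlade1993_cor325`

Topic `Literature/Barriers/CriticalPhenomena`; second proofs companion of `SAPAnisotropicNotDFinite`
(the barrier file of Rechnitzer's Corollary 27), which counts the self-avoiding polygons of `ℤ²`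
by horizontal and vertical half-perimeter: `rootedPolygonCount m n` (closed-up `(N-1)`-step
self-avoiding walks from `0` to a neighbour `e` of `0` with `2m` horizontal bonds, `N = 2(m+n)`;
Madras–Slade Definition 3.2.1 and eq. (3.2.1), "`2N q_N = 2d c_{N-1}(0,e)`"),
`polygonCount m n = rootedPolygonCount m n / 2N`, `isotropicPolygonCount N = q_N`, and vendors
**Corollary 3.2.5, eq. (3.2.9)** — "`μ_{Polygon} = lim_{n → ∞} (q_{2n})^{1/2n} = μ`" — as the named
fact `MadrasSlade1993_cor325` (`μ = Literature.Probability.RandomPlanarGeometry.SAW.connectiveConstant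
= infₙ cₙ^{1/n}`). This file PROVES it (`MadrasSlade1993_cor325_holds`).

## The printed proof and its formal counterpart

Source: N. Madras, G. Slade, *The Self-Avoiding Walk* (Birkhäuser 1993), §3.2: "Equation (3.2.9)
follows immediately from Equations (3.2.8) and (3.2.1)", where (3.2.8),
`μ^{2M} e^{-CM^{1/2}} ≤ c_{2M+1}(0,e) ≤ 2(M+1)(d-1)/d · μ^{2M+2}`, is "a direct consequence of
Theorem 3.2.4 [two bridges make a polygon: `c_{2M+1}(0,e) ≥ K M^{-d-2} (b_M)²`] and Equation
(3.1.9) [Corollary 3.1.6, the Hammersley–Welsh bound `μ^{N-1} e^{-BN^{1/2}} ≤ b_N`]" for the lower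
half; the upper half uses (3.2.5) (subadditivity of polygons, Theorem 3.2.3). Here:

* upper bound: `q_{2K} ≤ c_{2K-1}` (`isotropicPolygonCount_le_count`: by (3.2.1) every polygon
  class is represented by rooted self-avoiding walks, the horizontal classes being disjoint) and
  `c_{2M+1}^{1/(2M+2)} → μ` (`tendsto_count_rpow_succ`, from Fekete `cₙ^{1/n} → μ`,
  `Zd.tendsto_count_rpow`) — this replaces the printed route through (3.2.5), Theorem 3.2.3 not
  being needed for the limit;
* lower bound: the planar Theorem 3.2.4 refined by horizontal steps
  (`Zd.sq_bridgeCount_le_card_targetWalks` of `SAWPolygonsFromBridges.lean`: for `M ≥ 1` some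
  horizontal class of `(2M+1)`-step self-avoiding walks `0 → e = (0,-1)` has
  `≥ b_M² / ((2M+1)⁴(M+1)⁴)` elements), transported to the Walk-based counts of the fact file
  (`horizontalSteps_eq_hcount`, `card_targetWalks_le_rootedPolygonCount`), whence
  **`b_M² ≤ 64 (M+1)⁹ (q_{2M+2} + 1)`** (`sq_bridgeCount_le_isotropicPolygonCount`; the `+1`
  absorbs the integer division defining `polygonCount`); then Corollary 3.1.6
  (`Zd.exp_mul_pow_le_bridgeCount : e^{-c√M} μ^M ≤ b_M`, `HammersleyWelshBound.lean`) in the form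
  "`a^M < b_M` eventually, for every `1 ≤ a < μ`", exponential-beats-polynomial
  (`tendsto_pow_const_div_const_pow_of_one_lt`), and `μ ≥ 2 > 1`
  (`Zd.natCast_le_connectiveConstant`, `SAWPositiveWalks.lean`) give `a < (q_{2M+2})^{1/(2M+2)}`
  eventually for every `a < μ`;
* `MadrasSlade1993_cor325_of_bridge_growth` (the limit from the growth of `b_M`),
  `MadrasSlade1993_cor325_of_tendsto_bridgeCount_rpow` (from the printed form (3.1.10),
  `b_N^{1/N} → μ`), `MadrasSlade1993_cor325_of_exp_bound` (from (3.1.9)), and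
  **`MadrasSlade1993_cor325_holds`**.

## Design choices

* The two models of walks are bridged once: `horizontalSteps p = hcount p.length p.getVert`
  (`horizontalSteps`, darts of a Mathlib walk, is the primary notion of the fact file; `Zd.hcount`,
  on vertex functions, that of the combinatorial files), and `sawFun 2 N e` is by definition the
  `getVert`-image of the walks counted by `rootedPolygonCount`.
* No exact `2N`-to-one correspondence (3.2.1) is needed: inequalities suffice for the limit
  (`polygonCount ≤ rootedPolygonCount` upwards, `rooted < 2N (polygonCount + 1)` downwards).
-/

noncomputable section

namespace Literature.Barriers.CriticalPhenomena

open Filter Topology Finset SimpleGraph Literature.Probability.LatticeModels Literature.Probability.Percolation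
open Literature.Probability.RandomPlanarGeometry Literature.Probability.RandomPlanarGeometry.SAW.Zd
open scoped BigOperators

/-! ### Horizontal steps of a walk and of its vertex function -/

/-- The dart count `horizontalSteps` of a walk is the horizontal-step count `hcount` of its vertex
function. [folklore] -/
theorem horizontalSteps_eq_hcount {u v : Site 2} (p : (zdGraph 2).Walk u v) :
    horizontalSteps p = hcount p.length p.getVert := by
  induction p with
  | nil => simp [horizontalSteps, hcount]
  | cons h q ih =>
    rename_i a b c
    have hq : horizontalSteps q = q.darts.countP fun e => e.fst 1 = e.snd 1 := rfl
    rw [horizontalSteps, Walk.darts_cons, List.countP_cons, ← hq, ih, hcount_eq_sum, hcount_eq_sum,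
      Walk.length_cons, Finset.sum_range_succ']
    simp only [Walk.getVert_cons_succ, Walk.getVert_zero]
    congr 1
    by_cases hab : a 1 = b 1 <;> simp [hab]

/-! ### `q_N ≤ c_{N-1}` -/

/-- Neighbours of the origin lie in every box `{-L,…,L}²`, `L ≥ 1`. [folklore] -/
theorem mem_box_of_adj_zero {e : Site 2} (he : (zdGraph 2).Adj 0 e) {L : ℕ} (hL : 1 ≤ L) :
    e ∈ box 2 L := by
  rw [mem_box]
  intro j
  have := abs_sub_le_one_of_adj he j
  simp only [Pi.zero_apply, sub_zero] at this
  have hL' : (1 : ℤ) ≤ L := by exact_mod_cast hL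
  constructor <;> linarith [(abs_le.1 this).1, (abs_le.1 this).2]

/-- For a fixed closing bond `{e, 0}`, the rooted polygons through it, summed over the number `2m`
of horizontal bonds, are at most `c_{N-1}(0,e)` (the horizontal classes are disjoint sets of
`(N-1)`-step self-avoiding walks from `0` to `e`). [cite: MadrasSlade1993, §3.2, eq. (3.2.1)] -/
theorem sum_card_filter_le_countAt (K : ℕ) (e : Site 2) (c : ℕ) :
    ∑ m ∈ Finset.range (K + 1), (((zdGraph 2).finsetWalkLength (2 * K - 1) (0 : Site 2) e).filter
      fun p => p.IsPath ∧ horizontalSteps p + c = 2 * m).card ≤ countAt 2 (2 * K - 1) e := by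
  classical
  set S := (zdGraph 2).finsetWalkLength (2 * K - 1) (0 : Site 2) e with hS
  have hdisj : (↑(Finset.range (K + 1)) : Set ℕ).PairwiseDisjoint fun m =>
      S.filter fun p => p.IsPath ∧ horizontalSteps p + c = 2 * m := by
    intro m _ m' _ hmm'
    refine Finset.disjoint_left.2 fun p hp hp' => hmm' ?_
    rw [Finset.mem_filter] at hp hp'
    omega
  rw [← Finset.card_biUnion hdisj, countAt]
  refine Finset.card_le_card fun p hp => ?_
  rw [Finset.mem_biUnion] at hp
  obtain ⟨m, -, hm⟩ := hp
  rw [Finset.mem_filter] at hm ⊢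
  exact ⟨hm.1, hm.2.1⟩

/-- **`q_{2K} ≤ c_{2K-1}`** for `K ≥ 1` (from "`2N q_N = 2d c_{N-1}(0,e)`": every polygon class
contributes at most its rooted representatives). [cite: MadrasSlade1993, §3.2, eq. (3.2.1)] -/
theorem isotropicPolygonCount_le_count {K : ℕ} (hK : 1 ≤ K) :
    isotropicPolygonCount (2 * K) ≤ count 2 (2 * K - 1) := by
  classical
  have hdiv : 2 * K / 2 = K := by omega
  rw [isotropicPolygonCount, if_pos (even_two_mul K), hdiv]
  calc ∑ m ∈ Finset.range (K + 1), polygonCount m (K - m)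
      ≤ ∑ m ∈ Finset.range (K + 1), rootedPolygonCount m (K - m) :=
        Finset.sum_le_sum fun m _ => Nat.div_le_self _ _
    _ ≤ ∑ m ∈ Finset.range (K + 1), ∑ e ∈ (zdGraph 2).neighborFinset 0,
          (((zdGraph 2).finsetWalkLength (2 * K - 1) (0 : Site 2) e).filter
            fun p => p.IsPath ∧ horizontalSteps p + (if e 1 = 0 then 1 else 0) = 2 * m).card := by
        refine Finset.sum_le_sum fun m hm => ?_
        rw [Finset.mem_range] at hm
        have hmK : m + (K - m) = K := by omega
        rw [rootedPolygonCount, hmK]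
        split_ifs
        · exact Nat.zero_le _
        · exact le_rfl
    _ = ∑ e ∈ (zdGraph 2).neighborFinset 0, ∑ m ∈ Finset.range (K + 1),
          (((zdGraph 2).finsetWalkLength (2 * K - 1) (0 : Site 2) e).filter
            fun p => p.IsPath ∧ horizontalSteps p + (if e 1 = 0 then 1 else 0) = 2 * m).card :=
        Finset.sum_comm
    _ ≤ ∑ e ∈ (zdGraph 2).neighborFinset 0, countAt 2 (2 * K - 1) e :=
        Finset.sum_le_sum fun e _ => sum_card_filter_le_countAt K e _
    _ ≤ ∑ e ∈ box 2 (2 * K - 1), countAt 2 (2 * K - 1) e :=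
        Finset.sum_le_sum_of_subset_of_nonneg (fun e he => mem_box_of_adj_zero
          ((SimpleGraph.mem_neighborFinset _ _ _).1 he) (by omega)) fun _ _ _ => Nat.zero_le _
    _ = count 2 (2 * K - 1) := rfl

/-! ### `b_M² ≤ 64 (M+1)⁹ (q_{2M+2} + 1)` -/

/-- The horizontal-step class produced by Theorem 3.2.4 is a set of rooted `(2M+2)`-step polygons
with `2m` horizontal bonds: `#targetWalks M m ≤ rootedPolygonCount m (M+1-m)`.
[cite: MadrasSlade1993, Theorem 3.2.4 and eq. (3.2.1)] -/
theorem card_targetWalks_le_rootedPolygonCount {M m : ℕ} (hM : 1 ≤ M) (hm : m ≤ M) :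
    (targetWalks M m).card ≤ rootedPolygonCount m (M + 1 - m) := by
  classical
  have hmn : m + (M + 1 - m) = M + 1 := by omega
  -- the terms of `rootedPolygonCount m (M+1-m)`, one per closing bond `{e, 0}`
  set F : Site 2 → ℕ := fun e => (((zdGraph 2).finsetWalkLength (2 * M + 1) (0 : Site 2) e).filter
    fun p => p.IsPath ∧ horizontalSteps p + (if e 1 = 0 then 1 else 0) = 2 * m).card with hF
  have hrooted : rootedPolygonCount m (M + 1 - m) = ∑ e ∈ (zdGraph 2).neighborFinset 0, F e := by
    rw [rootedPolygonCount, if_neg (by omega), hmn, show 2 * (M + 1) - 1 = 2 * M + 1 by omega]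
  have he : eDown ∈ (zdGraph 2).neighborFinset (0 : Site 2) :=
    (SimpleGraph.mem_neighborFinset _ _ _).2 adj_zero_eDown
  have hite : (if eDown 1 = 0 then 1 else 0) = 0 := by simp
  -- `targetWalks M m` injects (via the traced walk) into the `eDown` term
  have hT : (targetWalks M m).card ≤ F eDown := by
    set W := ((zdGraph 2).finsetWalkLength (2 * M + 1) (0 : Site 2) eDown).filter
      fun p => p.IsPath ∧ horizontalSteps p + (if eDown 1 = 0 then 1 else 0) = 2 * m with hW
    have hFW : F eDown = W.card := rfl
    rw [hFW]
    calc (targetWalks M m).card ≤ (W.image fun p => p.getVert).card := by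
          refine Finset.card_le_card fun ω hω => ?_
          rw [targetWalks, Finset.mem_filter] at hω
          obtain ⟨hω, hc⟩ := hω
          rw [sawFun, Finset.mem_image] at hω
          obtain ⟨p, hp, rfl⟩ := hω
          rw [Finset.mem_filter, mem_finsetWalkLength_iff] at hp
          refine Finset.mem_image.2 ⟨p, ?_, rfl⟩
          rw [hW, Finset.mem_filter, mem_finsetWalkLength_iff, hite, add_zero, horizontalSteps_eq_hcount,
            hp.1]
          exact ⟨rfl, hp.2, hc⟩
      _ ≤ W.card := Finset.card_image_le
  rw [hrooted]
  exact hT.trans (Finset.single_le_sum (f := F) (fun _ _ => Nat.zero_le _) he)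

/-- **The polygon lower bound** behind Corollary 3.2.5 (Theorem 3.2.4 + (3.2.1), planar, with crude
constants): for `M ≥ 1`, `b_M² ≤ 64 (M+1)⁹ (q_{2M+2} + 1)`; the `+1` absorbs the integer division
in `polygonCount`. [cite: MadrasSlade1993, Theorem 3.2.4 and Corollary 3.2.5] -/
theorem sq_bridgeCount_le_isotropicPolygonCount {M : ℕ} (hM : 1 ≤ M) :
    bridgeCount 2 M ^ 2 ≤ 64 * (M + 1) ^ 9 * (isotropicPolygonCount (2 * M + 2) + 1) := by
  classical
  obtain ⟨m, hm, hle⟩ := sq_bridgeCount_le_card_targetWalks hM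
  have h1 := card_targetWalks_le_rootedPolygonCount hM hm
  -- `rooted < 4(M+1) (polygonCount + 1)`
  have h2 : rootedPolygonCount m (M + 1 - m) <
      2 * (2 * (M + 1)) * (polygonCount m (M + 1 - m) + 1) := by
    have hmn : m + (M + 1 - m) = M + 1 := by omega
    have := Nat.lt_div_mul_add (a := rootedPolygonCount m (M + 1 - m))
      (show 0 < 2 * (2 * (m + (M + 1 - m))) by omega)
    rw [polygonCount, hmn] at *
    linarith
  -- `polygonCount m (M+1-m) ≤ q_{2M+2}` (one term of the sum)
  have h3 : polygonCount m (M + 1 - m) ≤ isotropicPolygonCount (2 * M + 2) := by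
    have hdiv : (2 * M + 2) / 2 = M + 1 := by omega
    rw [isotropicPolygonCount, if_pos ⟨M + 1, by ring⟩, hdiv]
    exact Finset.single_le_sum (f := fun k => polygonCount k (M + 1 - k)) (fun _ _ => Nat.zero_le _)
      (Finset.mem_range.2 (by omega))
  have h4 : (2 * M + 1) ^ 4 ≤ 16 * (M + 1) ^ 4 := by
    calc (2 * M + 1) ^ 4 ≤ (2 * (M + 1)) ^ 4 := Nat.pow_le_pow_left (by omega) 4
      _ = 16 * (M + 1) ^ 4 := by ring
  calc bridgeCount 2 M ^ 2 ≤ (2 * M + 1) ^ 4 * (M + 1) ^ 4 * (targetWalks M m).card := hle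
    _ ≤ (2 * M + 1) ^ 4 * (M + 1) ^ 4 * (2 * (2 * (M + 1)) * (polygonCount m (M + 1 - m) + 1)) :=
        Nat.mul_le_mul_left _ (h1.trans h2.le)
    _ ≤ 16 * (M + 1) ^ 4 * (M + 1) ^ 4 * (2 * (2 * (M + 1)) * (isotropicPolygonCount (2 * M + 2) + 1)) := by
        gcongr
    _ = 64 * (M + 1) ^ 9 * (isotropicPolygonCount (2 * M + 2) + 1) := by ring

/-! ### The limit `(q_{2n})^{1/2n} → μ` -/

/-- `(c_{2M+1})^{1/(2M+2)} → μ` (from `cₙ^{1/n} → μ`, Fekete). [cite: MadrasSlade1993, §1.2, eq. (1.2.1)] -/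
theorem tendsto_count_rpow_succ :
    Tendsto (fun M : ℕ => (count 2 (2 * M + 1) : ℝ) ^ (1 / (2 * ((M + 1 : ℕ) : ℝ)))) atTop
      (𝓝 (connectiveConstant 2)) := by
  have hμ : (0 : ℝ) < connectiveConstant 2 := connectiveConstant_pos 2
  have hsub : Tendsto (fun M : ℕ => 2 * M + 1) atTop atTop :=
    tendsto_atTop_atTop.2 fun b => ⟨b, fun a ha => by omega⟩
  have hf : Tendsto (fun M : ℕ => (count 2 (2 * M + 1) : ℝ) ^ (1 / (((2 * M + 1 : ℕ)) : ℝ))) atTop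
      (𝓝 (connectiveConstant 2)) := (tendsto_count_rpow 2).comp hsub
  have hg : Tendsto (fun M : ℕ => (((2 * M + 1 : ℕ)) : ℝ) / ((((2 * M + 1 : ℕ)) : ℝ) + 1)) atTop (𝓝 1) :=
    (tendsto_natCast_div_add_atTop (1 : ℝ)).comp hsub
  have := hf.rpow hg (Or.inl hμ.ne')
  rw [Real.rpow_one] at this
  refine this.congr' (Eventually.of_forall fun M => ?_)
  have hc : (0 : ℝ) ≤ count 2 (2 * M + 1) := Nat.cast_nonneg _
  rw [← Real.rpow_mul hc]
  congr 1
  have h1 : (((2 * M + 1 : ℕ)) : ℝ) ≠ 0 := by positivity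
  have h2 : (((2 * M + 1 : ℕ)) : ℝ) + 1 ≠ 0 := by positivity
  field_simp
  push_cast
  ring

/-- **The core of Corollary 3.2.5**: if `b_M` grows at rate `μ` (for every `1 ≤ a < μ`, eventually
`a^M < b_M` — a consequence of the Hammersley–Welsh bound `b_M ≥ μ^M e^{-c√M}`, Corollary 3.1.6),
then `(q_{2n})^{1/2n} → μ`: the upper bound is `q_{2n} ≤ c_{2n-1}` and `cₙ^{1/n} → μ`, the lower
bound is `b_M² ≤ 64(M+1)⁹(q_{2M+2}+1)` and `μ ≥ 2 > 1`.
[cite: MadrasSlade1993, Corollary 3.2.5, eq. (3.2.9)] -/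
theorem MadrasSlade1993_cor325_of_bridge_growth
    (hB : ∀ a : ℝ, 1 ≤ a → a < connectiveConstant 2 →
      ∀ᶠ M : ℕ in atTop, a ^ M < (bridgeCount 2 M : ℝ)) :
    MadrasSlade1993_cor325 := by
  rw [MadrasSlade1993_cor325, ← connectiveConstant_two]
  set μ := connectiveConstant 2 with hμdef
  have hμ2 : (2 : ℝ) ≤ μ := by exact_mod_cast natCast_le_connectiveConstant 2
  set s : ℕ → ℝ := fun n => (isotropicPolygonCount (2 * n) : ℝ) ^ (1 / (2 * n : ℝ)) with hs
  have hs0 : ∀ n, 0 ≤ s n := fun n => Real.rpow_nonneg (Nat.cast_nonneg _) _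
  -- upper bound `s n ≤ U n`, `U n → μ`
  have hU : Tendsto (fun n : ℕ => (count 2 (2 * n - 1) : ℝ) ^ (1 / (2 * n : ℝ))) atTop (𝓝 μ) := by
    rw [← tendsto_add_atTop_iff_nat 1]
    refine tendsto_count_rpow_succ.congr' (Eventually.of_forall fun M => ?_)
    simp only [show 2 * (M + 1) - 1 = 2 * M + 1 by omega]
  have hsU : ∀ᶠ n : ℕ in atTop, s n ≤ (count 2 (2 * n - 1) : ℝ) ^ (1 / (2 * n : ℝ)) := by
    filter_upwards [eventually_ge_atTop 1] with n hn
    exact Real.rpow_le_rpow (Nat.cast_nonneg _) (by exact_mod_cast isotropicPolygonCount_le_count hn)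
      (by positivity)
  rw [tendsto_order]
  refine ⟨fun a ha => ?_, fun b hb => ?_⟩
  swap
  · filter_upwards [hsU, hU.eventually (gt_mem_nhds hb)] with n h1 h2
    exact h1.trans_lt h2
  -- lower bound
  rcases lt_or_ge a 0 with ha0 | ha0
  · exact Eventually.of_forall fun n => ha0.trans_le (hs0 n)
  set a₁ := max a 1 with ha₁
  have ha₁1 : 1 ≤ a₁ := le_max_right _ _
  have ha₁μ : a₁ < μ := max_lt ha (by linarith)
  set a' := (a₁ + μ) / 2 with ha'
  have h1a' : a₁ < a' := by rw [ha']; linarith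
  have ha'μ : a' < μ := by rw [ha']; linarith
  have ha'0 : 0 < a' := by linarith
  have ha₁0 : 0 < a₁ := by linarith
  -- exponential beats polynomial: eventually `128 a₁^{2M+2} (M+1)^9 < a'^{2M}`
  set r := (a' / a₁) ^ 2 with hr
  have hr1 : 1 < r := by
    rw [hr]; exact one_lt_pow₀ ((one_lt_div ha₁0).2 h1a') two_ne_zero
  have hpoly : Tendsto (fun M : ℕ => (((M + 1 : ℕ)) : ℝ) ^ 9 / r ^ M) atTop (𝓝 0) := by
    have h := (tendsto_add_atTop_iff_nat 1).2 (tendsto_pow_const_div_const_pow_of_one_lt 9 hr1)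
    have h' := h.const_mul r
    rw [mul_zero] at h'
    refine h'.congr' (Eventually.of_forall fun M => ?_)
    have : r ≠ 0 := by positivity
    simp only [pow_succ]
    field_simp
  have hev1 : ∀ᶠ M : ℕ in atTop, 128 * a₁ ^ (2 * M + 2) * (((M + 1 : ℕ)) : ℝ) ^ 9 < a' ^ (2 * M) := by
    have hε : (0 : ℝ) < 1 / (128 * a₁ ^ 2) := by positivity
    filter_upwards [hpoly.eventually (gt_mem_nhds hε)] with M hM
    have hrM : 0 < r ^ M := pow_pos (zero_lt_one.trans hr1) M
    rw [div_lt_div_iff₀ hrM (by positivity), one_mul] at hM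
    have hrM' : r ^ M * a₁ ^ (2 * M) = a' ^ (2 * M) := by
      rw [hr, ← pow_mul, div_pow, pow_mul, pow_mul, div_mul_cancel₀]
      exact pow_ne_zero _ (pow_ne_zero _ ha₁0.ne')
    calc 128 * a₁ ^ (2 * M + 2) * (((M + 1 : ℕ)) : ℝ) ^ 9
        = ((((M + 1 : ℕ)) : ℝ) ^ 9 * (128 * a₁ ^ 2)) * a₁ ^ (2 * M) := by ring
      _ < r ^ M * a₁ ^ (2 * M) := mul_lt_mul_of_pos_right hM (pow_pos ha₁0 _)
      _ = a' ^ (2 * M) := hrM'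
  have hev2 := hB a' (ha₁1.trans h1a'.le) ha'μ
  -- conclude along `n = M + 1`
  have key : ∀ᶠ M : ℕ in atTop, a < s (M + 1) := by
    filter_upwards [hev1, hev2, eventually_ge_atTop 1] with M h1 h2 hM
    have hq := sq_bridgeCount_le_isotropicPolygonCount hM
    set q := isotropicPolygonCount (2 * M + 2) with hqdef
    have hqR : (bridgeCount 2 M : ℝ) ^ 2 ≤ 64 * (((M + 1 : ℕ)) : ℝ) ^ 9 * ((q : ℝ) + 1) := by
      exact_mod_cast hq
    have hb2 : a' ^ (2 * M) < (bridgeCount 2 M : ℝ) ^ 2 := by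
      rw [pow_mul', ]
      exact pow_lt_pow_left₀ h2 (pow_nonneg ha'0.le _) two_ne_zero
    -- so `a₁^{2M+2} < q`
    have hq1 : a₁ ^ (2 * M + 2) < (q : ℝ) := by
      have hpos : (0 : ℝ) < (((M + 1 : ℕ)) : ℝ) ^ 9 := by positivity
      have : 128 * a₁ ^ (2 * M + 2) * (((M + 1 : ℕ)) : ℝ) ^ 9 <
          64 * (((M + 1 : ℕ)) : ℝ) ^ 9 * ((q : ℝ) + 1) := by linarith
      have h' : 2 * a₁ ^ (2 * M + 2) < (q : ℝ) + 1 := by nlinarith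
      have h1le : (1 : ℝ) ≤ a₁ ^ (2 * M + 2) := one_le_pow₀ ha₁1
      linarith
    have haq : a ^ (2 * M + 2) < (q : ℝ) :=
      lt_of_le_of_lt (pow_le_pow_left₀ ha0 (le_max_left a 1) _) hq1
    -- take `(2M+2)`-th roots
    have hn : (2 * (M + 1) : ℕ) ≠ 0 := by omega
    have hexp : (1 / (2 * ((M + 1 : ℕ) : ℝ)) : ℝ) = (((2 * (M + 1) : ℕ) : ℝ))⁻¹ := by
      push_cast; ring
    show a < (isotropicPolygonCount (2 * (M + 1)) : ℝ) ^ (1 / (2 * ((M + 1 : ℕ) : ℝ)))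
    rw [hexp, show 2 * (M + 1) = 2 * M + 2 by ring, ← hqdef]
    calc a = (a ^ (2 * M + 2)) ^ ((((2 * (M + 1) : ℕ) : ℝ))⁻¹) := by
          rw [show 2 * M + 2 = 2 * (M + 1) by ring, Real.pow_rpow_inv_natCast ha0 hn]
      _ < (q : ℝ) ^ ((((2 * (M + 1) : ℕ) : ℝ))⁻¹) :=
          Real.rpow_lt_rpow (pow_nonneg ha0 _) haq (by positivity)
  obtain ⟨M₀, hM₀⟩ := eventually_atTop.1 key
  refine eventually_atTop.2 ⟨M₀ + 1, fun n hn => ?_⟩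
  obtain ⟨M, rfl⟩ : ∃ M, n = M + 1 := ⟨n - 1, by omega⟩
  exact hM₀ M (by omega)

/-- Corollary 3.2.5 from the limit form `b_n^{1/n} → μ` of the Hammersley–Welsh bound
(Madras–Slade (3.1.10)). [cite: MadrasSlade1993, Corollary 3.1.6, eq. (3.1.10), and Corollary 3.2.5] -/
theorem MadrasSlade1993_cor325_of_tendsto_bridgeCount_rpow
    (h : Tendsto (fun n : ℕ => (bridgeCount 2 n : ℝ) ^ (1 / (n : ℝ))) atTop
      (𝓝 (connectiveConstant 2))) :
    MadrasSlade1993_cor325 := by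
  refine MadrasSlade1993_cor325_of_bridge_growth fun a ha1 haμ => ?_
  filter_upwards [h.eventually (lt_mem_nhds haμ), eventually_ge_atTop 1] with n hn hn1
  have hb : (0 : ℝ) ≤ bridgeCount 2 n := Nat.cast_nonneg _
  have hn0 : n ≠ 0 := by omega
  calc a ^ n < ((bridgeCount 2 n : ℝ) ^ (1 / (n : ℝ))) ^ n :=
        pow_lt_pow_left₀ hn (by linarith) hn0
    _ = bridgeCount 2 n := by rw [one_div, Real.rpow_inv_natCast_pow hb hn0]

/-- Corollary 3.2.5 from the Hammersley–Welsh bridge bound in the form of Corollary 3.1.6,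
`e^{-c√M} μ^M ≤ b_M` for all `M` (the tree's `Zd.exp_mul_pow_le_bridgeCount`, also the content of
`DKY2014_eq21`): for `1 ≤ a < μ` and `√M > |c| / log(μ/a)`, `a^M < e^{-c√M} μ^M ≤ b_M`.
[cite: MadrasSlade1993, Corollary 3.1.6, eq. (3.1.9), and Corollary 3.2.5] -/
theorem MadrasSlade1993_cor325_of_exp_bound
    (h : ∃ c : ℝ, ∀ n : ℕ,
      Real.exp (-(c * Real.sqrt n)) * connectiveConstant 2 ^ n ≤ (bridgeCount 2 n : ℝ)) :
    MadrasSlade1993_cor325 := by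
  refine MadrasSlade1993_cor325_of_bridge_growth fun a ha1 haμ => ?_
  obtain ⟨c, hc⟩ := h
  set μ := connectiveConstant 2 with hμ
  have ha0 : 0 < a := by linarith
  -- `L = log (μ / a) > 0`; for `√M > |c| / L`, `c √M < L M`, i.e. `a^M < e^{-c√M} μ^M`
  set L := Real.log (μ / a) with hL
  have hL0 : 0 < L := Real.log_pos ((one_lt_div ha0).2 haμ)
  refine eventually_atTop.2 ⟨Nat.ceil ((|c| / L) ^ 2) + 1, fun M hM => ?_⟩
  have hM0 : (0 : ℝ) < M := by exact_mod_cast (show 0 < M by omega)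
  have hsqrt : |c| / L < Real.sqrt M := by
    rw [Real.lt_sqrt (by positivity)]
    calc (|c| / L) ^ 2 ≤ Nat.ceil ((|c| / L) ^ 2) := Nat.le_ceil _
      _ < M := by exact_mod_cast (show Nat.ceil ((|c| / L) ^ 2) < M by omega)
  have hcM : c * Real.sqrt M < L * M := by
    have h1 : c * Real.sqrt M ≤ |c| * Real.sqrt M :=
      mul_le_mul_of_nonneg_right (le_abs_self c) (Real.sqrt_nonneg _)
    have h2 : |c| < L * Real.sqrt M := by rwa [div_lt_iff₀ hL0, mul_comm] at hsqrt
    have h3 : |c| * Real.sqrt M < L * Real.sqrt M * Real.sqrt M :=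
      mul_lt_mul_of_pos_right h2 (Real.sqrt_pos.2 hM0)
    rw [mul_assoc, Real.mul_self_sqrt hM0.le] at h3
    linarith
  have key : a ^ M < Real.exp (-(c * Real.sqrt M)) * μ ^ M := by
    have hμ0 : 0 < μ := by linarith
    have e1 : μ ^ M = a ^ M * Real.exp (L * M) := by
      rw [mul_comm L, Real.exp_nat_mul, hL, Real.exp_log (div_pos hμ0 ha0), ← mul_pow,
        mul_div_cancel₀ _ ha0.ne']
    rw [e1, ← mul_assoc, mul_comm (Real.exp _), mul_assoc, ← Real.exp_add]
    have : (0 : ℝ) < -(c * Real.sqrt M) + L * M := by linarith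
    have h1 : (1 : ℝ) < Real.exp (-(c * Real.sqrt M) + L * M) := Real.one_lt_exp_iff.2 this
    have haM : 0 < a ^ M := pow_pos ha0 M
    nlinarith
  exact key.trans_le (hc M)

/-- **Discharge of `MadrasSlade1993_cor325`** (Madras–Slade 1993, Corollary 3.2.5, eq. (3.2.9),
planar case: `μ_Polygon = limₙ (q_{2n})^{1/2n} = μ`): Theorem 3.2.4 (two bridges make a polygon,
`SAWPolygonsFromBridges.lean`), Corollary 3.1.6 (the Hammersley–Welsh bridge bound,
`HammersleyWelshBound.lean`), `q_{2K} ≤ c_{2K-1}`, `cₙ^{1/n} → μ` (Fekete) and `μ ≥ 2`.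
[cite: MadrasSlade1993, Corollary 3.2.5, eq. (3.2.9)] -/
theorem MadrasSlade1993_cor325_holds : MadrasSlade1993_cor325 :=
  MadrasSlade1993_cor325_of_exp_bound (SAW.Zd.exp_mul_pow_le_bridgeCount (d := 2))

end Literature.Barriers.CriticalPhenomena
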